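import Summits.Ventures.HodgeRepro2.T5RecordSatakeInertToyDegree
import Summits.Ventures.HodgeRepro2.T5RecordSatakeUnramified
import Summits.Ventures.HodgeRepro2.T5RecordSatakeToy
import Summits.Ventures.HodgeRepro2.T5SplitPrimeToy

/-!
# The record's spherical Hecke algebra at a CONCRETE split place: `ℚ(i)` at `5`, `H₀ = diag(1, 1, −1)`

Tier-5 support N3 / §G-N4.2 (seat p3, gen 78). File 231 says: at a place `v` of `K⁺` with two distinct places
`w ≠ w' = c • w` of the CM field `K` above it, `θ` a `v`-adic square, the record's spherical Hecke algebra
`H(U(1 ⊗ H), K_v)` is commutative (`U(V_v) ≅ GL_n(K⁺_v)`); file 234 reads «`θ` is a `v`-adic square» off «two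
distinct places above `v`» and constructs the conjugate place. This file first states that as the split counterpart
of file 236's stays-prime theorem — intrinsic and datum-free — and then reads it at ONE concrete split place of ONE
concrete CM field (README §10.5 (ii)(c)/(d)): `L = ℚ(ζ₄) = ℚ(i)`, the prime `5 = (2 − i)(2 + i)` (seat p8's
`T5SplitPrimeToy`: `wFiveA L ≠ wFiveB L`, both containing `5`), `H₀ = diag(1, 1, −1)` of file 237:

* **`heckeAlgebra_mul_comm_record_of_ne_of_liesOver`** — two distinct places of `K` over `v`, `H` good at one of
  them ⇒ `H(U(1 ⊗ H), K_v)` is commutative (any size `n`), with no auxiliary datum;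
* `absNorm_span_natCast_maximalRealSubfield`, `prime_natCast_maximalRealSubfield`, **`comap_eq_span_natCast`** —
  in `𝓞_{ℚ(i)⁺}` the prime `(p)` is the contraction of every place of `ℚ(i)` containing `p`;
* `five_ne_zero'`, `prime_five'`, `vFivePlus` — the place `(5)` of `ℚ(i)⁺`; `comap_wFiveA` / `comap_wFiveB`,
  `liesOver_vFivePlus_A` / `_B` — `wFiveA`, `wFiveB` lie over it;
  `absNorm_vFivePlus` — `N(v) = 5`; **`ncard_primesOver_vFivePlus`** — exactly two places of `ℚ(i)` above it;
* **`heckeAlgebra_mul_comm_record_five`** — `H(U(1 ⊗ H₀), K_{(5)})` is commutative, for every family `l` of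
  generators of `𝓞_{ℚ(i)}` over `𝓞_{ℚ(i)⁺}` and every field `k`;
* `exists_generators_and_heckeAlgebra_mul_comm_record_five` — with the generators supplied by file 235.

§8(d): uses an L-value-free non-vanishing device: NO.
-/

open Matrix NumberField NumberField.IsCMField IsDedekindDomain IsDedekindDomain.HeightOneSpectrum Module
open scoped TensorProduct Pointwise
open Summit.Ventures.HodgeRepro2.T5UnitaryGroupForm Summit.Ventures.HodgeRepro2.T5UnitaryHeckeAdjoint
  Summit.Ventures.HodgeRepro2.T5HeckePermutationModule Summit.Ventures.HodgeRepro2.T5StarOfInvolution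
  Summit.Ventures.HodgeRepro2.T5FinitePlaceCM Summit.Ventures.HodgeRepro2.T5FinitePlaceNormIndex
  Summit.Ventures.HodgeRepro2.T5NonSplitPlaceUnitaryGroup Summit.Ventures.HodgeRepro2.T5RecordHyperspecial
  Summit.Ventures.HodgeRepro2.T5GlobalLatticeAlmostAll Summit.Ventures.HodgeRepro2.T5FinitePlaceSplitClassification
  Summit.Ventures.HodgeRepro2.T5RecordSatake Summit.Ventures.HodgeRepro2.T5RecordSatakeInert
  Summit.Ventures.HodgeRepro2.T5QuadraticInertBridge Summit.Ventures.HodgeRepro2.T5FinitePlaceSplitIff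
  Summit.Ventures.HodgeRepro2.T5FinitePlaceCMDecomp Summit.Ventures.HodgeRepro2.T5BadPlacesFinite
  Summit.Ventures.HodgeRepro2.T5RecordSatakeUnramified Summit.Ventures.HodgeRepro2.T5CMFieldSquareDatum
  Summit.Ventures.HodgeRepro2.T5RecordSatakeToy Summit.Ventures.HodgeRepro2.T5SplitPrimeToy
  Summit.Ventures.HodgeRepro2.T5CMCensusToy Summit.Ventures.HodgeRepro2.T5RecordSatakeInertToy
  Summit.Ventures.HodgeRepro2.T5RecordSatakeInertToyDegree Summit.Ventures.HodgeRepro2.T5SplitPlaceUnitaryGroup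

namespace Summit.Ventures.HodgeRepro2.T5RecordSatakeSplitToy

section Generic

variable (K : Type*) [Field K] [NumberField K] [IsCMField K]
variable (v : HeightOneSpectrum (𝓞 (maximalRealSubfield K))) (w₁ w₂ : HeightOneSpectrum (𝓞 K))
variable {r : ℕ} (l : Fin r → 𝓞 K)

/-- **COMMUTATIVITY AT A PLACE WITH TWO PRIMES ABOVE IT, INTRINSIC AND DATUM-FREE** (the split counterpart of file
236's `heckeAlgebra_mul_comm_record_of_staysPrime`): if `w₁ ≠ w₂` are places of `K` over `v` and the hermitian
invertible Gram matrix `H` is good at `w₁`, the record's spherical Hecke algebra `H(U(1 ⊗ H), K_v)` is commutative —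
the datum `(θ, y)` of file 235 is chosen inside the proof, `θ` is a `v`-adic square by file 234's
`isSquare_of_ne_of_liesOver`, the conjugate place `c • w₁` by `exists_conj_place_of_isSquare`, and file 231's
`heckeAlgebra_mul_comm_record_split` concludes. -/
theorem heckeAlgebra_mul_comm_record_of_ne_of_liesOver (k : Type*) [Field k]
    (hl : Submodule.span (𝓞 (maximalRealSubfield K)) (Set.range l) = ⊤)
    (hne : w₁ ≠ w₂) [w₁.asIdeal.LiesOver v.asIdeal] [w₂.asIdeal.LiesOver v.asIdeal]
    {n : Type*} [Fintype n] [DecidableEq n]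
    {H : Matrix n n K} (hH : H.IsHermitian) (hdet : IsUnit H.det) (hgood : w₁ ∉ badSet H)
    (T S : (letI := tensorStarRing K v; ↥(heckeAlgebra k (recordHyperspecial K v l H)))) :
    T * S = S * T :=
  (exists_sq_eq_and_complexConj_ne K).elim fun _ h => h.elim fun _ h =>
    (exists_conj_place_of_isSquare K v w₁ h.1 h.2
      (isSquare_of_ne_of_liesOver K v h.1 h.2 w₁ w₂ hne inferInstance inferInstance)).elim fun w' hw' =>
      haveI := hw'.1
      heckeAlgebra_mul_comm_record_split K v w₁ w' hw'.2.1 h.1 h.2 hw'.2.2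
        (isSquare_of_ne_of_liesOver K v h.1 h.2 w₁ w₂ hne inferInstance inferInstance) l k hl hH hdet hgood T S

end Generic

section Norm

variable (L : Type*) [Field L] [CharZero L] [IsCyclotomicExtension {2 ^ 2} ℚ L]

/-- `N((m)) = m` in `𝓞_{ℚ(i)⁺}` (`[ℚ(i)⁺ : ℚ] = 1`, file 249). -/
theorem absNorm_span_natCast_maximalRealSubfield (m : ℕ) :
    haveI := numberField L; haveI := isCMField_four L
    Ideal.absNorm (Ideal.span {(m : 𝓞 (maximalRealSubfield L))}) = m := by
  haveI := numberField L
  haveI := isCMField_four L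
  rw [Ideal.absNorm_span_natCast, RingOfIntegers.rank, finrank_rat_maximalRealSubfield L, pow_one]

/-- A rational prime `p` is a prime element of `𝓞_{ℚ(i)⁺}` (its principal ideal has norm `p`, Mathlib's
`Ideal.prime_of_irreducible_absNorm_span`). -/
theorem prime_natCast_maximalRealSubfield {p : ℕ} (hp : p.Prime) :
    haveI := numberField L; haveI := isCMField_four L
    Prime (p : 𝓞 (maximalRealSubfield L)) := by
  haveI := numberField L
  haveI := isCMField_four L
  refine Ideal.prime_of_irreducible_absNorm_span (Nat.cast_ne_zero.mpr hp.ne_zero) ?_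
  rw [absNorm_span_natCast_maximalRealSubfield L]
  exact hp

/-- **The contraction of any place of `ℚ(i)` containing `p` is `(p)`**: `(p)` is a non-zero prime, hence maximal,
of the Dedekind domain `𝓞_{ℚ(i)⁺}`, and it lies below the contraction, which is proper. -/
theorem comap_eq_span_natCast {p : ℕ} (hp : p.Prime) (w : HeightOneSpectrum (𝓞 L))
    (hmem : (p : 𝓞 L) ∈ w.asIdeal) :
    haveI := numberField L; haveI := isCMField_four L
    Ideal.comap (algebraMap (𝓞 (maximalRealSubfield L)) (𝓞 L)) w.asIdeal =
      Ideal.span {(p : 𝓞 (maximalRealSubfield L))} := by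
  haveI := numberField L
  haveI := isCMField_four L
  have hne : (p : 𝓞 (maximalRealSubfield L)) ≠ 0 := Nat.cast_ne_zero.mpr hp.ne_zero
  have hprime : (Ideal.span {(p : 𝓞 (maximalRealSubfield L))}).IsPrime :=
    (Ideal.span_singleton_prime hne).mpr (prime_natCast_maximalRealSubfield L hp)
  have hmax : (Ideal.span {(p : 𝓞 (maximalRealSubfield L))}).IsMaximal :=
    hprime.isMaximal ((Ideal.span_singleton_eq_bot).not.mpr hne)
  refine (hmax.eq_of_le (Ideal.IsPrime.comap _).ne_top ?_).symm
  rw [Ideal.span_le, Set.singleton_subset_iff, SetLike.mem_coe, Ideal.mem_comap, map_natCast]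
  exact hmem

end Norm

section Place

variable (L : Type*) [Field L] [CharZero L] [IsCyclotomicExtension {2 ^ 2} ℚ L]

omit [IsCyclotomicExtension {2 ^ 2} ℚ L] in
/-- `5 ≠ 0` in `𝓞_{ℚ(i)⁺}` (characteristic `0`). -/
theorem five_ne_zero' : (5 : 𝓞 (maximalRealSubfield L)) ≠ 0 := by norm_num

/-- `5` is a prime element of `𝓞_{ℚ(i)⁺}`. -/
theorem prime_five' : haveI := numberField L; haveI := isCMField_four L; Prime (5 : 𝓞 (maximalRealSubfield L)) := by
  haveI := numberField L
  haveI := isCMField_four L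
  have h := prime_natCast_maximalRealSubfield L Nat.prime_five
  rwa [Nat.cast_ofNat] at h

/-- **The place `(5)` of `ℚ(i)⁺`.** -/
noncomputable def vFivePlus : HeightOneSpectrum (𝓞 (maximalRealSubfield L)) :=
  haveI := numberField L
  haveI := isCMField_four L
  { asIdeal := Ideal.span {(5 : 𝓞 (maximalRealSubfield L))}
    isPrime := (Ideal.span_singleton_prime (five_ne_zero' L)).mpr (prime_five' L)
    ne_bot := (Ideal.span_singleton_eq_bot).not.mpr (five_ne_zero' L) }

/-- The ideal of `vFivePlus` is `(5)`. -/
theorem vFivePlus_asIdeal : (vFivePlus L).asIdeal = Ideal.span {(5 : 𝓞 (maximalRealSubfield L))} := rfl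

/-- The contraction of `wFiveA = (2 − i)` is `(5)` (`5 ∈ wFiveA`, seat p8's `five_mem_A`). -/
theorem comap_wFiveA :
    haveI := numberField L; haveI := isCMField_four L
    Ideal.comap (algebraMap (𝓞 (maximalRealSubfield L)) (𝓞 L)) (wFiveA L).asIdeal = (vFivePlus L).asIdeal := by
  haveI := numberField L
  haveI := isCMField_four L
  rw [vFivePlus_asIdeal]
  have h5 : ((5 : ℕ) : 𝓞 L) ∈ (wFiveA L).asIdeal := by rw [Nat.cast_ofNat]; exact five_mem_A L
  have h := comap_eq_span_natCast L Nat.prime_five (wFiveA L) h5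
  rwa [Nat.cast_ofNat] at h

/-- The contraction of `wFiveB = (2 + i)` is `(5)` (seat p8's `five_mem_B`). -/
theorem comap_wFiveB :
    haveI := numberField L; haveI := isCMField_four L
    Ideal.comap (algebraMap (𝓞 (maximalRealSubfield L)) (𝓞 L)) (wFiveB L).asIdeal = (vFivePlus L).asIdeal := by
  haveI := numberField L
  haveI := isCMField_four L
  rw [vFivePlus_asIdeal]
  have h5 : ((5 : ℕ) : 𝓞 L) ∈ (wFiveB L).asIdeal := by rw [Nat.cast_ofNat]; exact five_mem_B L
  have h := comap_eq_span_natCast L Nat.prime_five (wFiveB L) h5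
  rwa [Nat.cast_ofNat] at h

/-- `wFiveA L` lies over `vFivePlus L`. -/
instance liesOver_vFivePlus_A : (wFiveA L).asIdeal.LiesOver (vFivePlus L).asIdeal :=
  haveI := numberField L
  haveI := isCMField_four L
  ⟨(comap_wFiveA L).symm⟩

/-- `wFiveB L` lies over `vFivePlus L`. -/
instance liesOver_vFivePlus_B : (wFiveB L).asIdeal.LiesOver (vFivePlus L).asIdeal :=
  haveI := numberField L
  haveI := isCMField_four L
  ⟨(comap_wFiveB L).symm⟩

/-- `N(vFivePlus) = 5`. -/
theorem absNorm_vFivePlus :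
    haveI := numberField L; haveI := isCMField_four L
    Ideal.absNorm (vFivePlus L).asIdeal = 5 := by
  haveI := numberField L
  haveI := isCMField_four L
  rw [vFivePlus_asIdeal]
  have h := absNorm_span_natCast_maximalRealSubfield L 5
  rwa [Nat.cast_ofNat] at h

/-- **Exactly two places of `ℚ(i)` lie above `(5)`**: at most two (`#{w ∣ v} ∈ {1, 2}` for a CM field), and
`wFiveA ≠ wFiveB` rules out one. -/
theorem ncard_primesOver_vFivePlus :
    haveI := numberField L; haveI := isCMField_four L
    ((vFivePlus L).asIdeal.primesOver (𝓞 L)).ncard = 2 := by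
  haveI := numberField L
  haveI := isCMField_four L
  rcases ncard_primesOver_eq_one_or_two L (vFivePlus L) with h | h
  · exact absurd (eq_of_liesOver_of_ncard_primesOver_eq_one L (vFivePlus L) (wFiveA L) h (wFiveB L)
      inferInstance).symm (wFiveA_ne_wFiveB L)
  · exact h

end Place

section Record

variable (L : Type*) [Field L] [CharZero L] [IsCyclotomicExtension {2 ^ 2} ℚ L]

/-- **THE RECORD'S SPHERICAL HECKE ALGEBRA AT THE SPLIT PLACE `(5)` OF `ℚ(i)` IS COMMUTATIVE**: for every family
`l` of generators of `𝓞_{ℚ(i)}` over `𝓞_{ℚ(i)⁺}` and every field `k`, `H(U(1 ⊗ H₀), K_{(5)})` is commutative —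
the generic theorem at `w₁ = wFiveA`, `w₂ = wFiveB` (`5 = (2 − i)(2 + i)`), `H₀` good at every finite place. -/
theorem heckeAlgebra_mul_comm_record_five (k : Type*) [Field k] {r : ℕ} (l : Fin r → 𝓞 L)
    (hl : Submodule.span (𝓞 (maximalRealSubfield L)) (Set.range l) = ⊤)
    (T S : (haveI := numberField L; haveI := isCMField_four L; letI := tensorStarRing L (vFivePlus L);
      ↥(heckeAlgebra k (recordHyperspecial L (vFivePlus L) l (gramToy L))))) :
    T * S = S * T :=
  haveI := numberField L
  haveI := isCMField_four L
  heckeAlgebra_mul_comm_record_of_ne_of_liesOver L (vFivePlus L) (wFiveA L) (wFiveB L) l k hl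
    (wFiveA_ne_wFiveB L) gramToy_isHermitian isUnit_det_gramToy (notMem_badSet_gramToy _) T S

/-- **With the generators supplied** (file 235's `exists_fin_span_eq_top`): the whole hypothesis set of the
split-place statement is inhabited on `ℚ(i)` at `5`. -/
theorem exists_generators_and_heckeAlgebra_mul_comm_record_five (k : Type*) [Field k] :
    haveI := numberField L; haveI := isCMField_four L
    ∃ (r : ℕ) (l : Fin r → 𝓞 L), Submodule.span (𝓞 (maximalRealSubfield L)) (Set.range l) = ⊤ ∧
      ∀ T S : (letI := tensorStarRing L (vFivePlus L);
          ↥(heckeAlgebra k (recordHyperspecial L (vFivePlus L) l (gramToy L)))), T * S = S * T :=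
  haveI := numberField L
  haveI := isCMField_four L
  (exists_fin_span_eq_top L).elim fun r h => h.elim fun l hl =>
    ⟨r, l, hl, fun T S => heckeAlgebra_mul_comm_record_five L k l hl T S⟩

end Record

end Summit.Ventures.HodgeRepro2.T5RecordSatakeSplitToy
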